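import Literature.AlgebraicGeometry.HodgeTheory.ComplexTorusIntegralHodgeClassesCoincidenceNumbers
import Literature.Geometry.Kaehler.ComplexTorusLefschetzNumber
import Literature.AlgebraicGeometry.HodgeTheory.ComplexTorusCategoryLatticeEquivalence
import HarnessLib

/-!
# The Lefschetz fixed-point formula on integral Hodge classes: `deg([Δ_X] · [Γ_f]) = Σ_k (−1)^k Tr(f^* | Hᵏ(X, ℚ))`

For an endomorphism `f` of a complex torus `X`, the number of fixed points computed as the intersection number of the diagonal and the
graph in `Hdg•(X × X, ℤ)` (g27-#4 `integralHodgeClassesDeg_diagonalClass_cup_graphClass`: `= #Ker(1_X − f) = |det(1 − ρ_r(f))|`) IS the Lefschetz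
number `Λ(f) = Σ_k (−1)^k Tr(f^*|Hᵏ(X, ℚ)) = det(1 − ρ_r(f))` of Layer A (`ComplexTorus.lefschetzNumber`, row A1-33: `lefschetzNumber_eq_det_one_sub`,
`lefschetzNumber_nonneg` for holomorphic `f`) — without absolute value, because `det(1 − ρ_r(f)) = |det(1 − ρ_a(f))|² ≥ 0` for a HOLOMORPHIC `f`:

* `det_one_sub_val_nonneg` — `det(1 − ρ_r(f)) ≥ 0` (`ρ_r(f)` commutes with `J`: the tree's `map_val_mul_jMatrix`, Prop. 1.1.6);
* **`integralHodgeClassesDeg_diagonalClass_cup_graphClass_eq_det`** — `deg([Δ_X] · [Γ_f]) = det(1 − ρ_r(f))` (in `ℤ`, no absolute value);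
* **`integralHodgeClassesDeg_diagonalClass_cup_graphClass_eq_lefschetzNumber`** — `deg([Δ_X] · [Γ_f]) = Λ(f)`;
* **`integralHodgeClassesDeg_diagonalClass_cup_graphClass_eq_sum_trace`** — `deg([Δ_X] · [Γ_f]) = Σ_{k=0}^{2g} (−1)^k Tr(f^*|Hᵏ(X, ℚ))` (Fulton's Example 16.1.15
  for `α = Γ_f`).

Everything is proved; no definition and no named fact is introduced (D-0026). The junction is BY NAME with Layer A; nothing there is restated.

## The sources, as printed

Fulton, *Intersection Theory* §16.1 (p0302 L27–L40): "**Example 16.1.15.** Lefschetz fixed point formula. […] `∫_{X×X} α · Δ = Σ (−1)ⁱ trace(α^*|Hⁱ X)`"; §16.2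
(p0303 L11): "The degree `∫ T · Δ` of the intersection is the *virtual number of fixed points* of T". Birkenhake–Lange, *Complex Abelian Varieties* Ch. 13
§1 (holomorphic Lefschetz fixed-point formula: `#Fix(f) = |det(1_g − ρ_a(f))|²`); Lange 2023 §1.1.2 Prop. 1.1.6 (`ρ_r(f) ⊗ 1 = ρ_a(f) ⊕ ρ̄_a(f)`), Prop. 1.1.13
(`deg h = |det ρ_r(h)|`), §2.4.1 Cor. 2.4.4 (a) (`N_r = |N_a|²`).

## References

* [Fulton1998] W. Fulton, *Intersection Theory*, 2nd ed., Springer (1998), §16.1 Example 16.1.15 (p0302 L27–L40), §16.2 (p0303 L11).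
* [Lange2023AbelianVarietiesComplex] H. Lange, *Abelian Varieties over the Complex Numbers*, Springer (2023), §1.1.2 Prop. 1.1.6 (p0019), Prop. 1.1.13
  (p0022), §2.4.1 Prop. 2.4.3 (b), Cor. 2.4.4 (a) (PDF p. 114).
* [LangeBirkenhake1992] H. Lange, Ch. Birkenhake, *Complex Abelian Varieties*, Springer (1992), Ch. 13 §1.
* [FarmakisMoskowitz2013] I. Farmakis, M. Moskowitz, *Fixed Point Theorems and Their Applications*, World Scientific (2013), §5.5–5.6 (PDF pp. 128–135).
-/

noncomputable section

open CategoryTheory Function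

namespace Literature.AlgebraicGeometry.HodgeTheory

open Literature.AlgebraicGeometry.Motives Literature.AlgebraicGeometry.Motives.HodgeStructure
open Literature.Geometry.Kaehler Literature.Geometry.Kaehler.ComplexTorus

namespace ComplexTorusCat

/-! ## §1 `det(1 − ρ_r(f)) ≥ 0` for an endomorphism of a complex torus -/

section Holomorphic

variable {X : ComplexTorusCat} (f : X ⟶ X)

/-- **`det(1 − ρ_r(f)) ≥ 0`** for an endomorphism of a complex torus (`= |det(1_V − ρ_a(f))|²`, Cor. 2.4.4 (a) applied to `1_X − f`; Layer A
`lefschetzNumber_nonneg`). [cite: Lange2023AbelianVarietiesComplex, §2.4.1 Cor. 2.4.4 (a) (PDF p. 114)] [cite: LangeBirkenhake1992, Ch. 13 §1] -/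
theorem det_one_sub_val_nonneg [LinearOrder X.toIsog.ι] : 0 ≤ (1 - f.1).det := by
  have h := lefschetzNumber_nonneg X.toIsog.Φ (map_val_mul_jMatrix f)
  rw [lefschetzNumber_eq_det_one_sub] at h
  exact_mod_cast h

end Holomorphic

/-! ## §2 `deg([Δ_X] · [Γ_f]) = det(1 − ρ_r(f)) = Λ(f) = Σ_k (−1)^k Tr(f^*|Hᵏ(X, ℚ))` -/

section Lefschetz

variable (X : ComplexTorusCat) {g G : ℕ} (hG : g + g = G) (f : X ⟶ X) (eX : Fin (2 * g) ≃ X.toIsog.ι) (e : Fin (2 * G) ≃ (prodObj X X).toIsog.ι)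
  (hX : 2 * g + 2 * 0 = 2 * g) (hg : g + g = 2 * g) (hc : 2 * g + 2 * g = 2 * G) (hG' : G + G = 2 * G)

/-- **`deg([Δ_X] · [Γ_f]) = det(1 − ρ_r(f))`** in `ℤ`, WITHOUT absolute value: g27-#4's `deg([Δ_X] · [Γ_f]) = #Ker(1_X − f) = |det(1 − ρ_r(f))|` and `det(1 − ρ_r(f)) ≥ 0` (§1) —
all fixed points of a holomorphic map count with multiplicity `+1`. [cite: Fulton1998, §16.2 (p0303 L11)] [cite: Lange2023AbelianVarietiesComplex, §1.1.2 Prop. 1.1.13 (p0022 L1–L14) and §2.4.1 Cor. 2.4.4 (a)] -/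
theorem integralHodgeClassesDeg_diagonalClass_cup_graphClass_eq_det [LinearOrder X.toIsog.ι] :
    integralHodgeClassesDeg (prodObj X X) e
        (integralHodgeClassesCup (prodObj X X).toIsog.Φ hG (integralHodgeClassesPushforward 0 g (diagHom X) eX e hX hg hc hG' (unitIntegralHodgeClass X))
          (integralHodgeClassesPushforward 0 g (graphHom f) eX e hX hg hc hG' (unitIntegralHodgeClass X))) =
      (1 - f.1).det := by
  rw [integralHodgeClassesDeg_diagonalClass_cup_graphClass_eq_natAbs_det X hG f eX e hX hg hc hG', Matrix.det_submatrix_equiv_self,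
    Int.natAbs_of_nonneg (det_one_sub_val_nonneg f)]

/-- **THE LEFSCHETZ FIXED-POINT FORMULA ON INTEGRAL HODGE CLASSES: `deg([Δ_X] · [Γ_f]) = Λ(f)`**, the Lefschetz number `Λ(f) = Σ_k (−1)^k Tr(f^*|Hᵏ(X, ℚ))` of
Layer A (`ComplexTorus.lefschetzNumber`, `= det(1 − ρ_r(f))`), for every endomorphism `f` of a complex torus — Fulton's Example 16.1.15 `∫_{X×X} α · Δ = Σ (−1)ⁱ
trace(α^*|Hⁱ X)` for `α = Γ_f` (`Γ_f^* = f^*`, Prop. 16.1.2 (c)). [cite: Fulton1998, §16.1 Example 16.1.15 (p0302 L27–L40) and Prop. 16.1.2 (c) (p0295 L25)]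
[cite: FarmakisMoskowitz2013, §5.6 (PDF p. 135)] -/
theorem integralHodgeClassesDeg_diagonalClass_cup_graphClass_eq_lefschetzNumber [LinearOrder X.toIsog.ι] :
    (integralHodgeClassesDeg (prodObj X X) e
        (integralHodgeClassesCup (prodObj X X).toIsog.Φ hG (integralHodgeClassesPushforward 0 g (diagHom X) eX e hX hg hc hG' (unitIntegralHodgeClass X))
          (integralHodgeClassesPushforward 0 g (graphHom f) eX e hX hg hc hG' (unitIntegralHodgeClass X))) : ℚ) =
      lefschetzNumber X.toIsog.Φ f.1 := by
  rw [integralHodgeClassesDeg_diagonalClass_cup_graphClass_eq_det X hG f eX e hX hg hc hG', lefschetzNumber_eq_det_one_sub]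

/-- **`deg([Δ_X] · [Γ_f]) = Σ_{k=0}^{2g} (−1)^k Tr(f^* | Hᵏ(X, ℚ))`** with `f^* = pullbackForms` on `Hᵏ(X, ℚ) = rationalForms Φ k` (Layer A's `lefschetzNumber_def`).
[cite: Fulton1998, §16.1 Example 16.1.15 (p0302 L27–L40)] [cite: FarmakisMoskowitz2013, §5.5.2 (PDF p. 133)] -/
theorem integralHodgeClassesDeg_diagonalClass_cup_graphClass_eq_sum_trace [LinearOrder X.toIsog.ι] :
    (integralHodgeClassesDeg (prodObj X X) e
        (integralHodgeClassesCup (prodObj X X).toIsog.Φ hG (integralHodgeClassesPushforward 0 g (diagHom X) eX e hX hg hc hG' (unitIntegralHodgeClass X))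
          (integralHodgeClassesPushforward 0 g (graphHom f) eX e hX hg hc hG' (unitIntegralHodgeClass X))) : ℚ) =
      ∑ k ∈ Finset.range (Fintype.card X.toIsog.ι + 1),
        (-1 : ℚ) ^ k * LinearMap.trace ℚ (rationalForms X.toIsog.Φ k) (pullbackForms X.toIsog.Φ X.toIsog.Φ f.1 k) := by
  rw [integralHodgeClassesDeg_diagonalClass_cup_graphClass_eq_lefschetzNumber X hG f eX e hX hg hc hG', lefschetzNumber_def]

end Lefschetz

end ComplexTorusCat

end Literature.AlgebraicGeometry.HodgeTheory
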